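import Summits.ValiantsHypothesis.ValiantsHypothesis.Theorems.BarrierLeverAnchoredDoorHitsLowerPairsRelApexSpec

/-!
# Support item `AnchoredDoorHitsLowerPairs` (stmt-ValiantsHypothesis-22510), line `anchored-peeling`:
# THE WEIGHTED APEX SPECIALISATION — apex `v⋆ ↦ x_n`, arbitrary TAIL WEIGHTS `D''(1 + α_γ x_n)` and ROOT WEIGHTS `D'' + β_γ x_n`

Helper file (`--supports stmt-ValiantsHypothesis-22510`; cell valiant-natproofs, rung V4, 𝒟-side door (c); registered line
`Cruxes/AnchoredDoorHitsLowerPairs/Lines/anchored_peeling.lean` v25, registered residual `Stmt.stub_ltRestNonCanonRS`; prover seat val-np-p1 gen 25;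
memo HOME/val-np-p1/g25/MEMO-weighted-apex-valnp1-g25.md). Closes NO item. Sequel: `…WApexLemma` (the WEIGHTED relative Apex Lemma) and `…WApexRecursion`.

WHY. The typed apex specialisation of `…RelApexSpec` (val-np-p1 g22) gives a TAIL vertex the `x_n`-tail of weight `1` and a ROOT vertex the extra root `n`
with weight `1`: at the split variable `x_n` a column `W ∌ v⋆` then reads `|W ∩ G₁| · t_W + Σ_{γ ∈ W ∩ G₂} t_{W∖γ}` on the rows through `n`, so the
column is LIFTED as soon as it MEETS the tail set. Here the weights are ARBITRARY complex numbers `α γ` (tails) and `β γ` (roots):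
`D_γ = D''_γ · (1 + α_γ x_n) + β_γ x_n`, and a column `W ∌ v⋆` reads `(Σ_{γ∈W} α_γ) · t_W + Σ_{γ∈W} β_γ · t_{W∖γ}` (`coeff_prod_doorElem_apexW_notMem`).
With SIGNED weights a column meeting the support of `α` can be BALANCED (`Σ_{γ∈W} α_γ = 0`) and stays in the top block: this is exactly the extra
freedom that makes the canonical pairs `(R₃, K₇)`, `(R₄, K₁₅)`, the g21 exception #881 and `cube₇ − top` versus `tB(9,3)` — none of which is
relatively apex-decomposable with indicator weights — decomposable (memo §2–§3). The algebra is that of `…RelApexSpec` verbatim with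
`tailInd G₁ ↦ α`, `rootInd G₂ ↦ β`; the typed specialisation is the case `α = tailInd G₁`, `β = rootInd G₂` (`apexThetaW_indicator`, `apexPhiW_indicator`).

WHAT THIS IS NOT: calculus only; nothing on crux stmt-ValiantsHypothesis-14610 or on `VP` versus `VNP`.
-/

set_option linter.dupNamespace false

namespace Summit.ValiantsHypothesis.ValiantsHypothesis.Theorems.BarrierLever.AnchoredPeeling

open Finset MvPolynomial
open Summit.ValiantsHypothesis.ValiantsHypothesis.Theorems.BarrierLever.BrickCalculus (pexpo pexpo_def pexpo_le_iff pexpo_sub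
  pexpo_apply_castAdd pexpo_apply_natAdd)

noncomputable section

variable {h : ℕ}

/-! ## The weighted apex specialisation of the doors -/

section ApexW

variable (θ'' : Fin h → Fin h → ℂ) (φ'' : Fin h → Fin h → Fin h → ℂ) (vs n : Fin h) (α β : Fin h → ℂ)

/-- Weighted apex root weights: the apex `v⋆` has the single root `n` (weight `1`); every other vertex `γ` gets the extra root `n` with weight `β γ`;
all other roots are those of `θ''` off `n`. -/
def apexThetaW : Fin h → Fin h → ℂ :=
  fun b γ => if γ = vs then (if b = n then 1 else 0) else (if b = n then β γ else θ'' b γ)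

/-- Weighted apex tail weights: the apex has no tails; every other vertex `γ` gets the `x_n`-tail `α γ` on its roots off `n`; the root `n` carries no
tails; all other tails are those of `φ''` off `n`. -/
def apexPhiW : Fin h → Fin h → Fin h → ℂ :=
  fun b γ b' => if γ = vs then 0 else (if b' = n then α γ else (if b = n then 0 else φ'' b γ b'))

/-- The typed specialisation is the weighted one with indicator weights (roots). -/
theorem apexThetaW_indicator (G₂ : Finset (Fin h)) : apexThetaW θ'' vs n (rootInd G₂) = apexThetaT θ'' vs n G₂ := by
  funext b γ; rw [apexThetaW, apexThetaT]

/-- The typed specialisation is the weighted one with indicator weights (tails). -/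
theorem apexPhiW_indicator (G₁ : Finset (Fin h)) : apexPhiW φ'' vs n (tailInd G₁) = apexPhiT φ'' vs n G₁ := by
  funext b γ b'; rw [apexPhiW, apexPhiT]

variable {θ'' φ'' vs n α β}

/-- **The apex door is `x_n`.** -/
theorem doorElem_apexW_self : doorElem (apexThetaW θ'' vs n β) (apexPhiW φ'' vs n α) vs = X (Fin.castAdd h n) := by
  classical
  rw [doorElem, Finset.sum_eq_single n]
  · rw [cfacCore]
    simp only [apexThetaW, apexPhiW, if_true, C_1, C_0, zero_mul, add_zero, Finset.prod_const_one, mul_one]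
    rw [pexpo_singleton_empty]; rfl
  · intro b _ hb
    rw [cfacCore]
    simp only [apexThetaW, if_true, if_neg hb, C_0, zero_mul, mul_zero]
  · intro hn; exact absurd (Finset.mem_univ n) hn

/-- Core factors off the apex and off the root `n`: `cfacCore(spec) b = cfacCore('') b · (1 + α_γ x_n)`. -/
theorem cfacCore_apexW_of_ne {γ : Fin h} (hγ : γ ≠ vs) (hφ : ∀ b, φ'' b γ n = 0) {b : Fin h} (hb : b ≠ n) :
    cfacCore (fun b => apexThetaW θ'' vs n β b γ) (fun b b' => apexPhiW φ'' vs n α b γ b') b =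
      cfacCore (fun b => θ'' b γ) (fun b b' => φ'' b γ b') b * (1 + C (α γ) * X (Fin.castAdd h n)) := by
  classical
  rw [cfacCore, cfacCore]
  have hsplit : ∀ (ψ : Fin h → ℂ), (∏ b' ∈ (univ \ {b} : Finset (Fin h)), (1 + C (ψ b') * X (Fin.castAdd h b')) : MvPolynomial (Fin (h + h)) ℂ) =
      (1 + C (ψ n) * X (Fin.castAdd h n)) * ∏ b' ∈ ((univ \ {b} : Finset (Fin h))).erase n, (1 + C (ψ b') * X (Fin.castAdd h b')) := by
    intro ψ
    have hn : n ∈ (univ \ {b} : Finset (Fin h)) := by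
      rw [Finset.mem_sdiff, Finset.mem_singleton]; exact ⟨Finset.mem_univ n, fun h' => hb h'.symm⟩
    exact (Finset.mul_prod_erase _ _ hn).symm
  rw [hsplit (fun b' => apexPhiW φ'' vs n α b γ b'), hsplit (fun b' => φ'' b γ b')]
  have hrest : (∏ b' ∈ ((univ \ {b} : Finset (Fin h))).erase n, (1 + C (apexPhiW φ'' vs n α b γ b') * X (Fin.castAdd h b')) :
      MvPolynomial (Fin (h + h)) ℂ) = ∏ b' ∈ ((univ \ {b} : Finset (Fin h))).erase n, (1 + C (φ'' b γ b') * X (Fin.castAdd h b')) :=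
    Finset.prod_congr rfl (fun b' hb' => by
      rw [apexPhiW]; simp only [if_neg hγ, if_neg (Finset.ne_of_mem_erase hb'), if_neg hb])
  rw [hrest]
  simp only [apexThetaW, apexPhiW, if_neg hγ, if_neg hb, if_true, hφ b, C_0, zero_mul, add_zero, one_mul]
  ring

/-- The core factor of the extra root `n` of a non-apex vertex is `β_γ · x_n` (no tails). -/
theorem cfacCore_apexW_root {γ : Fin h} (hγ : γ ≠ vs) :
    cfacCore (fun b => apexThetaW θ'' vs n β b γ) (fun b b' => apexPhiW φ'' vs n α b γ b') n = C (β γ) * X (Fin.castAdd h n) := by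
  classical
  rw [cfacCore]
  have h1 : (∏ b' ∈ (univ \ {n} : Finset (Fin h)), (1 + C (apexPhiW φ'' vs n α n γ b') * X (Fin.castAdd h b')) :
      MvPolynomial (Fin (h + h)) ℂ) = 1 :=
    Finset.prod_eq_one (fun b' hb' => by
      have hb'n : b' ≠ n := by
        rw [Finset.mem_sdiff, Finset.mem_singleton] at hb'; exact hb'.2
      rw [apexPhiW]; simp only [if_neg hγ, if_neg hb'n, if_true, C_0, zero_mul, add_zero])
  rw [h1, mul_one, pexpo_singleton_empty, apexThetaW]
  simp only [if_neg hγ, if_true]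
  rw [mul_comm]; rfl

/-- **Doors off the apex: `D_γ = D''_γ · (1 + α_γ x_n) + β_γ x_n`.** -/
theorem doorElem_apexW_of_ne {γ : Fin h} (hγ : γ ≠ vs) (hθ : θ'' n γ = 0) (hφ : ∀ b, φ'' b γ n = 0) :
    doorElem (apexThetaW θ'' vs n β) (apexPhiW φ'' vs n α) γ =
      doorElem θ'' φ'' γ * (1 + C (α γ) * X (Fin.castAdd h n)) + C (β γ) * X (Fin.castAdd h n) := by
  classical
  rw [doorElem, doorElem, ← Finset.add_sum_erase _ _ (Finset.mem_univ n),
    ← Finset.add_sum_erase Finset.univ (fun b => cfacCore (fun b => θ'' b γ) (fun b b' => φ'' b γ b') b) (Finset.mem_univ n),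
    cfacCore_apexW_root hγ, cfacCore_eq_zero_of_theta hθ, zero_add, Finset.sum_mul,
    Finset.sum_congr rfl (fun b hb => cfacCore_apexW_of_ne hγ hφ (Finset.ne_of_mem_erase hb))]
  ring

/-- **Column of a family member avoiding the apex**: `t_W` on rows `U ∌ n`; `(Σ_{γ∈W} α_γ)·t_W + Σ_{γ∈W} β_γ·t_{W∖γ}` (read at `U ∖ n`) on rows `U ∋ n`. -/
theorem coeff_prod_doorElem_apexW_notMem {W : Finset (Fin h)} (hW : vs ∉ W) (hθ : ∀ γ, θ'' n γ = 0) (hφ : ∀ b γ, φ'' b γ n = 0)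
    (U : Finset (Fin h)) :
    coeff (pexpo U ∅) (∏ γ ∈ W, doorElem (apexThetaW θ'' vs n β) (apexPhiW φ'' vs n α) γ) =
      if n ∈ U then
        (∑ γ ∈ W, α γ) * coeff (pexpo (U.erase n) ∅) (∏ γ ∈ W, doorElem θ'' φ'' γ) +
          ∑ γ ∈ W, β γ * coeff (pexpo (U.erase n) ∅) (∏ δ ∈ W.erase γ, doorElem θ'' φ'' δ)
      else coeff (pexpo U ∅) (∏ γ ∈ W, doorElem θ'' φ'' γ) := by
  classical
  set A : Fin h → MvPolynomial (Fin (h + h)) ℂ := fun γ => doorElem θ'' φ'' γ with hA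
  set B : Fin h → MvPolynomial (Fin (h + h)) ℂ := fun γ => C (α γ) * doorElem θ'' φ'' γ + C (β γ) with hB
  have hfac : ∀ γ ∈ W, doorElem (apexThetaW θ'' vs n β) (apexPhiW φ'' vs n α) γ = A γ + X (Fin.castAdd h n) * B γ := by
    intro γ hγ
    rw [doorElem_apexW_of_ne (fun heq => hW (by rw [← heq]; exact hγ)) (hθ γ) (fun b => hφ b γ), hA, hB]
    ring
  rw [Finset.prod_congr rfl hfac]
  obtain ⟨R', hR'⟩ := prod_add_X_mul n A B W
  have hAfree : ∀ γ, XFree n (A γ) := fun γ => xFree_doorElem (hθ γ) (fun b => hφ b γ)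
  have hPfree : XFree n (∏ γ ∈ W, A γ) := xFree_prod W A (fun γ _ => hAfree γ)
  rw [hR', coeff_pexpo_add_X_mul_add_sq hPfree]
  by_cases hn : n ∈ U
  · rw [if_pos hn, if_pos hn, coeff_sum, Finset.sum_mul, ← Finset.sum_add_distrib]
    refine Finset.sum_congr rfl (fun γ hγ => ?_)
    rw [hB]
    simp only
    rw [add_mul, mul_assoc, Finset.mul_prod_erase W A hγ, coeff_add, coeff_C_mul, coeff_C_mul]
  · rw [if_neg hn, if_neg hn]

/-- **Column of a family member through the apex**: `0` on rows `U ∌ n`, `t_{W∖v⋆}` (read at `U ∖ n`) on rows `U ∋ n`. -/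
theorem coeff_prod_doorElem_apexW_mem {W : Finset (Fin h)} (hW : vs ∈ W) (hθ : ∀ γ, θ'' n γ = 0) (hφ : ∀ b γ, φ'' b γ n = 0)
    (U : Finset (Fin h)) :
    coeff (pexpo U ∅) (∏ γ ∈ W, doorElem (apexThetaW θ'' vs n β) (apexPhiW φ'' vs n α) γ) =
      if n ∈ U then coeff (pexpo (U.erase n) ∅) (∏ γ ∈ W.erase vs, doorElem θ'' φ'' γ) else 0 := by
  classical
  rw [← Finset.mul_prod_erase W _ hW, doorElem_apexW_self, coeff_pexpo_X_mul]
  by_cases hn : n ∈ U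
  · rw [if_pos hn, if_pos hn, coeff_prod_doorElem_apexW_notMem (Finset.notMem_erase vs W) hθ hφ, if_neg (Finset.notMem_erase n U)]
  · rw [if_neg hn, if_neg hn]

end ApexW

end

end Summit.ValiantsHypothesis.ValiantsHypothesis.Theorems.BarrierLever.AnchoredPeeling
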